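import Summits.ABC.ABC.Theses.PadicPrimesKappaDoorTwoThirds
import Summits.ABC.ABC.Theorems.PadicPrimesYuNinetyOddRadOneClosers
import HarnessLib

set_option linter.dupNamespace false

/-!
# Route PadicPrimesKappaDoorTwoThirds (rung A1.M2, `stewartYu1991_upperBound`): the support item
# `FinBoundMerge` (stmt-ABC-19463) and the `Assembly` (stmt-ABC-19464)

`Summits/ABC/ABC/Theorems/PadicPrimesKappaDoorTwoThirdsClosers.lean` — cell `abc-stewartyu`, seat p3
(g2). Bookkeeping (planner: "provable-now"): the merge of the three residue classes `p ≡ 3`,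
`p ≡ 1 (mod 4)`, `p = 2` takes `K = max (max K₃ K₁) K₂`, `L = max (max L₃ L₁) L₂` (monotonicity of the
κ-door input `KappaDoor.FinBoundAt p K L 1 2 1 2` in `K, L`: `finBoundAt_mono_KL`), every prime being
`2` or odd; the Assembly is the route's `closes`. Everything is [folklore]. WHAT THIS IS NOT: the three
engine cruxes and the three-slot door `KappaDoorSpec` are untouched.
-/

noncomputable section

open Finset Real

namespace Summit.ABC.ABC.Theorems

open Summit.ABC.StewartYu Summit.ABC.StewartYu.KappaDoor

/-- **Item stmt-ABC-19463 `FinBoundMerge`**: the three residue-class inputs merge to one input at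
every prime, with the maximum of the constants. [folklore] -/
theorem padicPrimesKappaDoorTwoThirds_finBoundMerge_proof :
    Summit.ABC.ABC.Theses.PadicPrimesKappaDoorTwoThirds.FinBoundMerge := by
  rintro ⟨K₃, L₃, hK₃, hL₃, h₃⟩ ⟨K₁, L₁, hK₁, hL₁, h₁⟩ ⟨K₂, L₂, hK₂, hL₂, h₂⟩
  refine ⟨max (max K₃ K₁) K₂, max (max L₃ L₁) L₂,
    le_max_of_le_left (le_max_of_le_left hK₃), le_max_of_le_left (le_max_of_le_left hL₃),
    fun p hp => ?_⟩
  rcases hp.eq_two_or_odd with h2 | hodd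
  · have hP : FinBoundAt p K₂ L₂ 1 2 1 2 := h₂ p hp h2
    exact finBoundAt_mono_KL hK₂ (le_max_right _ _) (by linarith) (le_max_right _ _) hP
  · have h13 : p % 4 = 1 ∨ p % 4 = 3 := by omega
    rcases h13 with h | h
    · have hP : FinBoundAt p K₁ L₁ 1 2 1 2 := h₁ p hp h
      exact finBoundAt_mono_KL hK₁ ((le_max_right _ _).trans (le_max_left _ _)) (by linarith)
        ((le_max_right _ _).trans (le_max_left _ _)) hP
    · have hP : FinBoundAt p K₃ L₃ 1 2 1 2 := h₃ p hp h
      exact finBoundAt_mono_KL hK₃ ((le_max_left _ _).trans (le_max_left _ _)) (by linarith)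
        ((le_max_left _ _).trans (le_max_left _ _)) hP

/-- **Item stmt-ABC-19464 `Assembly`** of route `PadicPrimesKappaDoorTwoThirds`: the route's own
deciding theorem `closes`. [folklore] -/
theorem padicPrimesKappaDoorTwoThirds_assembly_proof :
    Summit.ABC.ABC.Theses.PadicPrimesKappaDoorTwoThirds.Assembly :=
  fun h₃ h₂ h₁ hD hM => Summit.ABC.ABC.Theses.PadicPrimesKappaDoorTwoThirds.closes h₃ h₂ h₁ hD hM

end Summit.ABC.ABC.Theorems

end
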